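import Summits.RiemannHypothesis.RiemannHypothesis.Theorems.Splittings.PolyDoorCountTools

/-!
# LINE L13 «DBR POLYNOMIAL DOOR» — APEX: the exact count `#{E_p = 0} ∩ ℂ₊ = #{p = 0} ∩ ℂ₊`

Cell rh-split, route `DeBrangesSuzukiDoor`, item `stmt-RiemannHypothesis-21502` (`PolyDoorCount`, the line's APEX;
registrar rh-split-dbr-neg g16; THEOREM B of card SPLIT-dbr-neg §20 at `h = 0`).  For a real polynomial `p` with
complexification `P = p.map (algebraMap ℝ ℂ)`, the door `E_p = P + i P′` has exactly as many zeros (with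
multiplicity) in the open upper half-plane as `P` has.

Proof (the classical homotopy, Hermite–Biehler for `(p, p′)`; Levin 1964 ch. VII; tools in
`PolyDoorCountTools.lean`):  normalise `p` to be monic of degree `n ≥ 1` and deform `E_t := P + i t P′`, `t ∈ ℝ`,
a monic degree-`n` family realised as characteristic polynomials of a continuous family of companion matrices, so
the tree's continuity-of-counts engine (`Literature.LinearAlgebra.Matrix.Gershgorin.…`) applies.
* LOCAL CONSTANCY on `t ≠ 0`: `N⁺(t) = #{roots in Im > 0}` can only grow nearby (open set),
  `#{Im ≥ 0} = N⁺ + #{Im = 0}` can only drop (closed set), and `#{Im = 0}` is constant (pinned real roots,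
  `filter_real_roots_eq`); hence `N⁺` is constant on `(0, ∞)`.
* SMALL `t > 0`: with `V := {Im < 0} ∪ ⋃_x B(x, δ)` over the real roots `x` of `P` (open, containing exactly the
  non-upper roots of `P`) the engine gives `#{E_t-roots in V} ≥ n − N⁺(0)` and `N⁺(t) ≥ N⁺(0)`, while by
  `local_sign` no root of `E_t` in `V` has `Im > 0`; so `N⁺(t) = N⁺(0)` for small `t > 0`, and by constancy
  `N⁺(1) = N⁺(0)`.
* General real `p ≠ 0`: divide by the leading coefficient (roots and the door are unchanged up to the unit).

Proved BY VALUE (the item's `payload.signature` verbatim; the route file does not yet declare the decl).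
E-GENERAL, RH-free.  This is a RECORD line: RH is NOT proved by this, nor approached.
HONEST LABEL: known mathematics (Hermite–Biehler root count for `(p, p′)`), 0 summit credit; nothing here bears on
the truth of RH.
-/

set_option linter.dupNamespace false

namespace Summit.RiemannHypothesis.RiemannHypothesis.Theorems.Splittings.PolyDoorCount

open Polynomial Filter Topology Set
open Summit.RiemannHypothesis.RiemannHypothesis.Theorems.Splittings.PolyDoorCountTools

/-! ## The count along the deformation -/

/-- **The apex for a monic complex polynomial, real on the real axis.**  If `P` is monic of positive degree and
`P, P′` take real values on `ℝ`, then `P + i P′` has exactly as many roots in the open upper half-plane as `P`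
(with multiplicity). [folklore] (Hermite–Biehler root count for `(p, p′)`; Levin, *Distribution of zeros of
entire functions*, ch. VII.) -/
theorem countP_upper_door_eq_of_monic {P : ℂ[X]} (hP : P.Monic) (hpos : 0 < P.natDegree)
    (hreal : ∀ x : ℝ, (P.eval (x : ℂ)).im = 0 ∧ ((derivative P).eval (x : ℂ)).im = 0) :
    (P + C Complex.I * derivative P).roots.countP (fun z => 0 < z.im) =
      P.roots.countP (fun z => 0 < z.im) := by
  classical
  obtain ⟨A, hA, hAE⟩ := exists_matrix_family hP rfl hpos
  have hP0 : P ≠ 0 := hP.ne_zero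
  have hE0 : ∀ t : ℝ, P + C (Complex.I * t) * derivative P ≠ 0 := fun t =>
    (monic_add_C_mul_derivative hP hpos _).1.ne_zero
  have hcardP : Multiset.card P.roots = P.natDegree :=
    ((IsAlgClosed.splits P).natDegree_eq_card_roots).symm
  have hcardE : ∀ t : ℝ, Multiset.card (P + C (Complex.I * t) * derivative P).roots = P.natDegree := by
    intro t
    obtain ⟨-, hdeg⟩ := monic_add_C_mul_derivative hP hpos (Complex.I * t)
    rw [← hdeg]
    exact ((IsAlgClosed.splits _).natDegree_eq_card_roots).symm
  have hopen : IsOpen {z : ℂ | 0 < z.im} := isOpen_lt continuous_const Complex.continuous_im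
  -- STEP 1: the upper count is locally constant on `t ≠ 0`
  have hloc : ∀ t₀ : ℝ, t₀ ≠ 0 → ∀ᶠ t : ℝ in 𝓝 t₀,
      (P + C (Complex.I * (t : ℂ)) * derivative P).roots.countP (fun z => 0 < z.im) =
        (P + C (Complex.I * (t₀ : ℂ)) * derivative P).roots.countP (fun z => 0 < z.im) := by
    intro t₀ ht₀
    have h1 := eventually_le_countP_of_isOpen hA hAE (q := fun z => 0 < z.im) hopen t₀
    have h2 := eventually_countP_le_of_isClosed hA hAE (q := fun z => 0 ≤ z.im)
      (isClosed_le continuous_const Complex.continuous_im) t₀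
    filter_upwards [h1, h2, eventually_ne_nhds ht₀] with t h1 h2 ht
    have e1 := countP_im_nonneg_eq (P + C (Complex.I * t) * derivative P).roots
    have e2 := countP_im_nonneg_eq (P + C (Complex.I * t₀) * derivative P).roots
    have r1 : (P + C (Complex.I * t) * derivative P).roots.countP (fun z => z.im = 0) =
        Multiset.card ((derivative P).roots.filter (fun z => z.im = 0 ∧ P.eval z = 0)) := by
      rw [Multiset.countP_eq_card_filter, filter_real_roots_eq hP0 hreal ht]
    have r2 : (P + C (Complex.I * t₀) * derivative P).roots.countP (fun z => z.im = 0) =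
        Multiset.card ((derivative P).roots.filter (fun z => z.im = 0 ∧ P.eval z = 0)) := by
      rw [Multiset.countP_eq_card_filter, filter_real_roots_eq hP0 hreal ht₀]
    omega
  -- STEP 2: hence constant on `(0, ∞)`
  have hcont : ContinuousOn
      (fun t : ℝ => (P + C (Complex.I * t) * derivative P).roots.countP (fun z => 0 < z.im)) (Ioi 0) := by
    intro t₀ ht₀
    have hca : ContinuousAt
        (fun t : ℝ => (P + C (Complex.I * t) * derivative P).roots.countP (fun z => 0 < z.im)) t₀ :=
      continuousAt_const.congr ((hloc t₀ (ne_of_gt ht₀)).mono fun t ht => ht.symm)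
    exact hca.continuousWithinAt
  have hconst : ∀ s t : ℝ, 0 < s → 0 < t →
      (P + C (Complex.I * s) * derivative P).roots.countP (fun z => 0 < z.im) =
        (P + C (Complex.I * t) * derivative P).roots.countP (fun z => 0 < z.im) :=
    fun s t hs ht => isPreconnected_Ioi.constant hcont hs ht
  -- STEP 3: small `t > 0`.  Real roots `S`, upper roots `Up` of `P`.
  set S : Finset ℂ := P.roots.toFinset.filter (fun z => z.im = 0) with hS
  set Up : Finset ℂ := P.roots.toFinset.filter (fun z => 0 < z.im) with hUp
  have hδS : ∀ x ∈ S, ∀ᶠ δ in 𝓝[>] (0 : ℝ), ∀ t : ℝ, 0 < t → t < δ → ∀ w : ℂ, ‖w - x‖ < δ →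
      (P + C (Complex.I * t) * derivative P).eval w = 0 → w = x ∨ w.im < 0 := by
    intro x hx
    have hxS := Finset.mem_filter.1 hx
    have hPx : P.eval x = 0 := (mem_roots hP0).1 (Multiset.mem_toFinset.1 hxS.1)
    obtain ⟨r, hfac, hndvd⟩ := P.exists_eq_pow_rootMultiplicity_mul_and_not_dvd hP0 x
    have hm : 0 < P.rootMultiplicity x := (rootMultiplicity_pos hP0).2 hPx
    have hrx : r.eval x ≠ 0 := fun h => hndvd (dvd_iff_isRoot.2 h)
    obtain ⟨k, hk⟩ : ∃ k, P.rootMultiplicity x = k + 1 := ⟨P.rootMultiplicity x - 1, by omega⟩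
    rw [hk] at hfac
    obtain ⟨δ₀, hδ₀, hgood⟩ := local_sign r x hrx k
    filter_upwards [Ioo_mem_nhdsGT hδ₀] with δ hδ
    intro t ht htδ w hw hEw
    rw [hfac] at hEw
    rcases hgood t ht (htδ.trans hδ.2) w (hw.trans hδ.2) hEw with h | h
    · exact Or.inl h
    · right
      rwa [Complex.sub_im, hxS.2, sub_zero] at h
  have hδUp : ∀ a ∈ Up, ∀ᶠ δ in 𝓝[>] (0 : ℝ), δ < a.im := by
    intro a ha
    filter_upwards [Ioo_mem_nhdsGT (Finset.mem_filter.1 ha).2] with δ hδ using hδ.2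
  obtain ⟨δ, hδpos, hgoodS, hgoodUp⟩ := ((eventually_mem_nhdsWithin : ∀ᶠ δ in 𝓝[>] (0 : ℝ), δ ∈ Ioi 0).and
    (((Filter.eventually_all_finset S).2 hδS).and ((Filter.eventually_all_finset Up).2 hδUp))).exists
  replace hδpos : 0 < δ := hδpos
  -- the open set `V = {Im < 0} ∪ ⋃_{x ∈ S} B(x, δ)` holds exactly the non-upper roots of `P`
  set V : Set ℂ := {z : ℂ | z.im < 0} ∪ ⋃ x ∈ S, Metric.ball x δ with hV
  have hVopen : IsOpen V :=
    (isOpen_lt Complex.continuous_im continuous_const).union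
      (isOpen_iUnion fun x => isOpen_iUnion fun _ => Metric.isOpen_ball)
  have hVP : ∀ z ∈ P.roots, (z ∈ V) = ¬ (0 < z.im) := by
    intro z hz
    refine propext ⟨fun hzV hzim => ?_, fun hzim => ?_⟩
    · rcases hzV with hneg | hball
      · exact lt_asymm hzim hneg
      · obtain ⟨x, hxS, hzx⟩ := Set.mem_iUnion₂.1 hball
        have hzUp : z ∈ Up := Finset.mem_filter.2 ⟨Multiset.mem_toFinset.2 hz, hzim⟩
        have h1 : δ < z.im := hgoodUp z hzUp
        have h2 : z.im ≤ ‖z - x‖ := by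
          have := Complex.abs_im_le_norm (z - x)
          rw [Complex.sub_im, (Finset.mem_filter.1 hxS).2, sub_zero] at this
          exact (le_abs_self _).trans this
        rw [Metric.mem_ball, Complex.dist_eq] at hzx
        linarith
    · rcases lt_or_eq_of_le (not_lt.1 hzim) with hlt | heq
      · exact Or.inl hlt
      · have hzS : z ∈ S := Finset.mem_filter.2 ⟨Multiset.mem_toFinset.2 hz, heq⟩
        exact Or.inr (Set.mem_iUnion₂.2 ⟨z, hzS, Metric.mem_ball_self hδpos⟩)
  have hPV : P.roots.countP (fun z => 0 < z.im) + P.roots.countP (fun z => z ∈ V) =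
      Multiset.card P.roots := by
    rw [Multiset.card_eq_countP_add_countP (fun z => 0 < z.im) P.roots, Multiset.countP_congr rfl hVP]
  -- the engine at `t₀ = 0`
  have h3 := eventually_le_countP_of_isOpen hA hAE (q := fun z => z ∈ V) hVopen 0
  have h4 := eventually_le_countP_of_isOpen hA hAE (q := fun z => 0 < z.im) hopen 0
  simp only [Complex.ofReal_zero, mul_zero, map_zero, zero_mul, add_zero] at h3 h4
  have hltδ : ∀ᶠ t in 𝓝 (0 : ℝ), t < δ := Iio_mem_nhds hδpos
  obtain ⟨t, ht0, htδ, h3t, h4t⟩ := ((eventually_mem_nhdsWithin : ∀ᶠ t in 𝓝[>] (0 : ℝ), t ∈ Ioi 0).and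
    ((hltδ.and (h3.and h4)).filter_mono nhdsWithin_le_nhds)).exists
  replace ht0 : 0 < t := ht0
  -- no root of `E_t` in `V` lies in the upper half-plane
  have hdisj : ∀ w ∈ (P + C (Complex.I * t) * derivative P).roots, 0 < w.im → w ∈ V → False := by
    intro w hw hwim hwV
    rcases hwV with hneg | hball
    · exact lt_asymm hwim hneg
    · obtain ⟨x, hxS, hwx⟩ := Set.mem_iUnion₂.1 hball
      rw [Metric.mem_ball, Complex.dist_eq] at hwx
      have hEw := (mem_roots (hE0 t)).1 hw
      rcases hgoodS x hxS t ht0 htδ w hwx hEw with h | h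
      · rw [h, (Finset.mem_filter.1 hxS).2] at hwim
        exact lt_irrefl _ hwim
      · exact lt_asymm hwim h
  have hsum := countP_add_countP_le_card (P + C (Complex.I * t) * derivative P).roots
    (fun z => 0 < z.im) (fun z => z ∈ V) hdisj
  have hcE := hcardE t
  have hNt : (P + C (Complex.I * t) * derivative P).roots.countP (fun z => 0 < z.im) =
      P.roots.countP (fun z => 0 < z.im) := by omega
  -- conclude at `t = 1`
  have h1 := hconst 1 t one_pos ht0
  rw [Complex.ofReal_one, mul_one] at h1
  rw [h1, hNt]

/-- **APEX of LINE L13 (item `stmt-RiemannHypothesis-21502`, `PolyDoorCount` by value).**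
For every real polynomial `p`, the door `E_p = p_ℂ + i p_ℂ′` has exactly as many roots (with multiplicity) in the
open upper half-plane as `p_ℂ` (THEOREM B of card SPLIT-dbr-neg §20 at `h = 0`). [folklore] (Hermite–Biehler root
count for `(p, p′)`; Levin, *Distribution of zeros of entire functions*, ch. VII.)  RECORD line: nothing here bears
on the truth of RH. -/
theorem polyDoorCount :
    ∀ p : Polynomial ℝ, (p.map (algebraMap ℝ ℂ) + Polynomial.C Complex.I *
      Polynomial.derivative (p.map (algebraMap ℝ ℂ))).roots.countP (fun z => 0 < z.im) =
      (p.map (algebraMap ℝ ℂ)).roots.countP (fun z => 0 < z.im) := by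
  intro p
  by_cases hp : p = 0
  · subst hp
    simp
  -- normalise to a monic polynomial
  have hc0 : p.leadingCoeff ≠ 0 := leadingCoeff_ne_zero.2 hp
  have hqm : (C p.leadingCoeff⁻¹ * p).Monic := monic_C_mul_of_mul_leadingCoeff_eq_one (inv_mul_cancel₀ hc0)
  have hQ : (C p.leadingCoeff⁻¹ * p).map (algebraMap ℝ ℂ) =
      C ((p.leadingCoeff⁻¹ : ℝ) : ℂ) * p.map (algebraMap ℝ ℂ) := by
    rw [Polynomial.map_mul, map_C]
    rfl
  have hu : ((p.leadingCoeff⁻¹ : ℝ) : ℂ) ≠ 0 := Complex.ofReal_ne_zero.2 (inv_ne_zero hc0)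
  have hQm : ((C p.leadingCoeff⁻¹ * p).map (algebraMap ℝ ℂ)).Monic := hqm.map _
  -- the monic case
  have key : ((C p.leadingCoeff⁻¹ * p).map (algebraMap ℝ ℂ) + C Complex.I *
      derivative ((C p.leadingCoeff⁻¹ * p).map (algebraMap ℝ ℂ))).roots.countP (fun z => 0 < z.im) =
      ((C p.leadingCoeff⁻¹ * p).map (algebraMap ℝ ℂ)).roots.countP (fun z => 0 < z.im) := by
    rcases Nat.eq_zero_or_pos ((C p.leadingCoeff⁻¹ * p).map (algebraMap ℝ ℂ)).natDegree with h0 | hpos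
    · rw [derivative_of_natDegree_zero h0, mul_zero, add_zero]
    · exact countP_upper_door_eq_of_monic hQm hpos fun x =>
        ⟨by rw [PolyDoorRealAxis.eval_map_ofReal, Complex.ofReal_im],
          by rw [PolyDoorRealAxis.eval_derivative_map_ofReal, Complex.ofReal_im]⟩
  have hE : (C p.leadingCoeff⁻¹ * p).map (algebraMap ℝ ℂ) + C Complex.I *
      derivative ((C p.leadingCoeff⁻¹ * p).map (algebraMap ℝ ℂ)) =
      C ((p.leadingCoeff⁻¹ : ℝ) : ℂ) * (p.map (algebraMap ℝ ℂ) + Polynomial.C Complex.I *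
        Polynomial.derivative (p.map (algebraMap ℝ ℂ))) := by
    rw [hQ, derivative_C_mul]
    ring
  rw [hE, hQ, roots_C_mul _ hu, roots_C_mul _ hu] at key
  exact key

end Summit.RiemannHypothesis.RiemannHypothesis.Theorems.Splittings.PolyDoorCount
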